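/-
Copyright (c) 2026 the pub-hodgecm-mathlib formalisation cell (harness21).  Prover seat hodgecm-mathlib-A-p19 (g27), 2026-09-02.  Road «S3-tree»∕«S3-ram» (LEAD F0P3a-plan (g12)
T11-41∕T11-52; owner p06 (g15)), row «R2²-ram», organ «(D2-γ)-ram ENGINE: FROM A FRAME-LEVEL LAW TO THE TOKEN-LEVEL LAW» — field-generic twin of ★ B-p14 (g37)
`TypeTwoSelfDualCyclicParity.exists_selfDual_cyclic_iff_even_log` §0–§4 (nodes and Gram values from the (D1) eigen-data, ★ `exists_symmetric_eigenframe`), closing with ANY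
frame-level law of ★ p847397's shape (hypothesis `hlaw`) and ★ `RationalGoodVectorRamifiedPlaceEigenData`.
-/
import Literature.NumberTheory.Automorphic.RationalGoodVectorRamifiedPlaceEigenData   -- ★-to-be (this seat): `exists_rational_norm_law_iff_of_eigenData`
import Literature.NumberTheory.Automorphic.SymmetricEigenframeExists                 -- ★ frame p846649 B-p14 (g37): `exists_symmetric_eigenframe`
import Literature.NumberTheory.Automorphic.SplitTorusOrderStratumParity              -- ★ `exists_poly_eval_mul_eq_one`
import Literature.NumberTheory.Automorphic.RationalCyclicSelfDualLattices               -- ★ seam p846609: brings `unitaryGroupOfForm`, `formCongr`, `glInt`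
import Literature.NumberTheory.Automorphic.ValuedFieldValuativeRelBridge             -- ★ `v_le_one_iff_mem_integer`
import HarnessLib

/-!
# From a frame-level law to the token-level law for the self-dual `τ`-cyclic lattices of a type-(2) unitary `τ` (Rogawski 1990 §4.9; Jacobowitz 1962 §7)

Topic `NumberTheory/Automorphic`; namespace `Literature.NumberTheory.Automorphic.SymmetricEigenframe`.  THEOREMS ONLY (no definition, no instance, no notation, no named fact, no
`sorry`); kernel lane `--supports stmt-HodgeConjecture-24833`.  Cell `pub/hodgecm-mathlib` (D-0151), crux H413; road «S3-tree», seeding wave «S3-ram», row «R2²-ram»; organ **«(D2-γ)-ram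
ENGINE»** (this seat), FIELD-GENERIC: valued fields `j : E → K` with `|j x| = |x|` (the UNRAMIFIED eigen-field of a tame-ramified CM place), involutions `σ` of `E`, `σ_K` (over `σ`) and
`ι` (over `id`, `Fix ι = j(E)`, `ιθ = −θ`) of `K`, `|2| = 1`; a `σ`-hermitian `J ∈ GL₃(E)`, a unitary `τ` with `χ_τ = (X − u)(X² − tX + D)`, `σu·u = 1`, `|u − 1| < 1`, a rational
`u`-eigenvector `x₀ ≠ 0`, and an eigenvalue `λ ∈ K` with `λ² − (jt)λ + jD = 0`, `|λ − 1| < 1`, `λ·σ_Kλ = 1`, `ιλ ≠ λ` (the (D1)-ram eigen-data).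

* **`exists_selfDual_cyclic_iff_rational_norm_of_frameLaw`** — IF the frame-level law holds for `(σ_K, ι, θ, J, τ)` (hypothesis `hlaw`: for every symmetric eigenframe `(P, γ, d, r)`
  with ★ p847163's node∕Gram-value facts, «self-dual `τ`-cyclic lattices exist iff `∃ a, ιa = a ∧ a·σ_K a·(−(θσ_Kθ)·d 0·det J_K·x₀₁x₀₂·x₁₂²) = 1`» — the literal conclusion of ★
  `exists_selfDual_cyclic_iff_rational_norm_type{A,B}_of_ramified`), THEN **`(∃ w, ∃ g ∈ U(σ,J), 𝒪[τ]w = 𝒪³gᵀ) ↔ ∃ z : E, z·σz·(d₀·det J·(u² − tu + D)∕((1+u)²(1+t+D))) = 1`**,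
  `d₀ = Σ σ(x₀ᵢ) Jᵢₖ x₀ₖ` the Gram value of the rational eigenvector.  Proof = ★ B-p14's §0–§4 (nodes `γ = (ju, λ, ιλ)`: integral units, `σ_Kγ = γ⁻¹`, distinct, CONGRUENT
  (`|γᵢ − γₖ| < 1` from `u ≡ 1 ≡ λ`), `ι`-symmetric; `r` by ★ `exists_poly_eval_mul_eq_one`; frame and Gram values by ★ `exists_symmetric_eigenframe`), then `hlaw`, then ★
  `exists_rational_norm_law_iff_of_eigenData` with Vieta `λ + ιλ = jt`, `λ·ιλ = jD`.  HONEST LABEL: HC_CM is proved only modulo the 2 remaining named inputs (hLiu418 24832, h413 24833)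
  until rung 0 closes; field algebra, count-neutral.

## References
* [Rogawski1990] J. D. Rogawski, *Automorphic Representations of Unitary Groups in Three Variables* (1990): §4.9 Lemma 4.9.3 p. 56, Prop. 4.9.1 (b) p. 55.
* [Jacobowitz1962] R. Jacobowitz, *Hermitian forms over local fields*, Amer. J. Math. 84 (1962): §7 Thm. 7.1.
-/

set_option autoImplicit false

noncomputable section

open Finset Matrix Polynomial
open scoped MatrixGroups ValuativeRel WithZero
open ValuativeRel

namespace Literature.NumberTheory.Automorphic.SymmetricEigenframe

open Literature.NumberTheory.Automorphic Literature.NumberTheory.Automorphic.UnitaryGroup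

/-- **(D2-γ)-ram ENGINE: the token-level law from a frame-level law** (see the module docstring). [cite: Rogawski1990, §4.9 Lemma 4.9.3 p. 56, Prop. 4.9.1 (b) p. 55]
[cite: Jacobowitz1962, §7 Thm. 7.1] -/
theorem exists_selfDual_cyclic_iff_rational_norm_of_frameLaw
    {E K : Type*} [Field E] [Valued E ℤᵐ⁰] [ValuativeRel E] [(Valued.v : Valuation E ℤᵐ⁰).Compatible]
    [Field K] [Valued K ℤᵐ⁰] [ValuativeRel K] [(Valued.v : Valuation K ℤᵐ⁰).Compatible]
    (σ : E →+* E) (hσσ : ∀ x, σ (σ x) = x) (h2 : Valued.v (2 : E) = 1)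
    (J : GL (Fin 3) E) (hJh : ((J : Matrix (Fin 3) (Fin 3) E).map σ)ᵀ = J)
    (τ : Matrix (Fin 3) (Fin 3) E) (hτU : (τ.map σ)ᵀ * (J : Matrix (Fin 3) (Fin 3) E) * τ = J)
    {u t D : E} (hχ : τ.charpoly = (X - C u) * (X ^ 2 - C t * X + C D))
    (hσu : σ u * u = 1) (hu1 : Valued.v (u - 1) < 1)
    {x₀ : Fin 3 → E} (hx₀ : τ *ᵥ x₀ = u • x₀) (hx₀0 : x₀ ≠ 0)
    (j : E →+* K) (hjv : ∀ x, Valued.v (j x) = Valued.v x)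
    (σK ι : K →+* K) (hσj : ∀ x, σK (j x) = j (σ x)) (hσKσK : ∀ y, σK (σK y) = y) (hσKv : ∀ y, Valued.v (σK y) = Valued.v y)
    (hιj : ∀ x, ι (j x) = j x) (hιι : ∀ y, ι (ι y) = y) (hιv : ∀ y, Valued.v (ι y) = Valued.v y) (hσKι : ∀ y, σK (ι y) = ι (σK y))
    (hfix : ∀ y : K, ι y = y → ∃ x, j x = y)
    {θ : K} (hθ0 : θ ≠ 0) (hιθ : ι θ = -θ)
    {lam : K} (hquad : lam ^ 2 - j t * lam + j D = 0) (hlam1 : Valued.v (lam - 1) < 1) (hσlam : lam * σK lam = 1) (hne : ι lam ≠ lam)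
    (hlaw : ∀ (P : GL (Fin 3) K) (γ d : Fin 3 → K) (r : (𝒪[K])[X]),
      τ.map j = (P : Matrix (Fin 3) (Fin 3) K) * diagonal γ * ((P⁻¹ : GL (Fin 3) K) : Matrix (Fin 3) (Fin 3) K) →
      formCongr σK P (((J : Matrix (Fin 3) (Fin 3) E)).map j) = diagonal d →
      (∀ i, ι ((P : Matrix (Fin 3) (Fin 3) K) i 0) = (P : Matrix (Fin 3) (Fin 3) K) i 0) →
      (∀ i, ι ((P : Matrix (Fin 3) (Fin 3) K) i 1) = (P : Matrix (Fin 3) (Fin 3) K) i 2) →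
      (∀ i, ι ((P : Matrix (Fin 3) (Fin 3) K) i 2) = (P : Matrix (Fin 3) (Fin 3) K) i 1) →
      (∀ i, γ i ∈ 𝒪[K]) → Function.Injective γ → (∀ i, σK (γ i) = (γ i)⁻¹) →
      (∀ i, (r.map (𝒪[K]).subtype).eval (γ i) * γ i = 1) →
      (∀ i, ∃ y ∈ 𝒪[K], y * (1 + γ i) = 1) → (∀ i, γ i ≠ 0) → (∀ i k, Valued.v (γ i - γ k) < 1) →
      ι (γ 0) = γ 0 → ι (γ 1) = γ 2 → ι (γ 2) = γ 1 →
      (∀ i, σK (d i) = d i) → (∀ i, d i ≠ 0) → ι (d 0) = d 0 → ι (d 1) = d 2 →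
      ((∃ w : Fin 3 → E, ∃ g ∈ unitaryGroupOfForm σ (J : Matrix (Fin 3) (Fin 3) E),
          Submodule.span 𝒪[E] (Set.range fun k : Fin 3 => (τ ^ (k : ℕ)) *ᵥ w) = Submodule.span 𝒪[E] (Set.range ((g : Matrix (Fin 3) (Fin 3) E))ᵀ)) ↔
        ∃ a : K, ι a = a ∧ a * σK a * (-(θ * σK θ) * d 0 * (((J : Matrix (Fin 3) (Fin 3) E)).map j).det *
          ((γ 0 - γ 1) / ((1 + γ 0) * (1 + γ 1)) * ((γ 0 - γ 2) / ((1 + γ 0) * (1 + γ 2)))) * ((γ 1 - γ 2) / ((1 + γ 1) * (1 + γ 2))) ^ 2) = 1)) :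
    (∃ w : Fin 3 → E, ∃ g ∈ unitaryGroupOfForm σ (J : Matrix (Fin 3) (Fin 3) E),
      Submodule.span 𝒪[E] (Set.range fun k : Fin 3 => (τ ^ (k : ℕ)) *ᵥ w) = Submodule.span 𝒪[E] (Set.range ((g : Matrix (Fin 3) (Fin 3) E))ᵀ)) ↔
    ∃ z : E, z * σ z * ((∑ k, ∑ i, σ (x₀ i) * (J : Matrix (Fin 3) (Fin 3) E) i k * x₀ k) * (J : Matrix (Fin 3) (Fin 3) E).det *
      ((u ^ 2 - t * u + D) / ((1 + u) ^ 2 * (1 + t + D)))) = 1 := by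
  classical
  /- §0 bookkeeping -/
  have hO : ∀ x ∈ 𝒪[K], Valued.v x ≤ 1 := fun x hx => (v_le_one_iff_mem_integer x).2 hx
  have hjO : ∀ x : E, j x ∈ 𝒪[K] ↔ x ∈ 𝒪[E] := fun x => by
    rw [← v_le_one_iff_mem_integer, ← v_le_one_iff_mem_integer, hjv]
  have h2K : Valued.v (2 : K) = 1 := by rw [← map_ofNat j 2, hjv, h2]
  have h2K0 : (2 : K) ≠ 0 := fun h => by rw [h, map_zero] at h2K; exact zero_ne_one h2K
  have hιj' : ∀ y, ι y = y ↔ ∃ x, j x = y := fun y => ⟨hfix y, fun ⟨x, hx⟩ => by rw [← hx, hιj]⟩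
  /- §1 the eigenvalues `γ = (j u, λ, ι λ)`: non-zero, norm one, integral, `|1 + γ_i| = 1`, congruent, pairwise distinct -/
  have hσu' : σ u = u⁻¹ := eq_inv_of_mul_eq_one_left hσu
  have hu0 : u ≠ 0 := fun h => by rw [h, mul_zero] at hσu; exact zero_ne_one hσu
  have hlam0 : lam ≠ 0 := fun h => by rw [h, zero_mul] at hσlam; exact zero_ne_one hσlam
  have hσlam' : σK lam = lam⁻¹ := eq_inv_of_mul_eq_one_right hσlam
  have hvu : Valued.v u = 1 := by
    have h := Valuation.map_one_add_of_lt (Valued.v : Valuation E ℤᵐ⁰) hu1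
    rwa [add_sub_cancel] at h
  have hvlam : Valued.v lam = 1 := by
    have h := Valuation.map_one_add_of_lt (Valued.v : Valuation K ℤᵐ⁰) hlam1
    rwa [add_sub_cancel] at h
  have hlamO : lam ∈ 𝒪[K] := (v_le_one_iff_mem_integer lam).1 hvlam.le
  have hvE1u : Valued.v (1 + u) = 1 := by
    have hlt : Valued.v (u - 1) < Valued.v (2 : E) := by rw [h2]; exact hu1
    have h := Valuation.map_add_eq_of_lt_left (Valued.v : Valuation E ℤᵐ⁰) hlt
    rw [h2] at h
    rwa [show (1 : E) + u = 2 + (u - 1) by ring]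
  have hv1ju : Valued.v (1 + j u) = 1 := by rw [← map_one j, ← map_add, hjv, hvE1u]
  have hv1lam : Valued.v (1 + lam) = 1 := by
    have hlt : Valued.v (lam - 1) < Valued.v (2 : K) := by rw [h2K]; exact hlam1
    have h := Valuation.map_add_eq_of_lt_left (Valued.v : Valuation K ℤᵐ⁰) hlt
    rw [h2K] at h
    rwa [show (1 : K) + lam = 2 + (lam - 1) by ring]
  have hv1ιlam : Valued.v (1 + ι lam) = 1 := by rw [← map_one ι, ← map_add, hιv, hv1lam]
  have hju1 : Valued.v (j u - 1) < 1 := by rw [← map_one j, ← map_sub, hjv]; exact hu1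
  have hιlam1 : Valued.v (ι lam - 1) < 1 := by rw [← map_one ι, ← map_sub, hιv]; exact hlam1
  have hγO : ∀ i, (![j u, lam, ι lam] : Fin 3 → K) i ∈ 𝒪[K] := by
    intro i
    fin_cases i
    · exact (hjO u).2 ((v_le_one_iff_mem_integer u).1 hvu.le)
    · exact hlamO
    · show ι lam ∈ 𝒪[K]
      exact (v_le_one_iff_mem_integer _).1 (by rw [hιv]; exact hO _ hlamO)
  have hσγ : ∀ i, σK ((![j u, lam, ι lam] : Fin 3 → K) i) = ((![j u, lam, ι lam] : Fin 3 → K) i)⁻¹ := by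
    intro i
    fin_cases i
    · show σK (j u) = (j u)⁻¹
      rw [hσj, hσu', map_inv₀]
    · exact hσlam'
    · show σK (ι lam) = (ι lam)⁻¹
      rw [hσKι, hσlam', map_inv₀]
  have hγne : ∀ i, (![j u, lam, ι lam] : Fin 3 → K) i ≠ 0 := by
    intro i
    fin_cases i
    · exact (map_ne_zero j).2 hu0
    · exact hlam0
    · exact (map_ne_zero ι).2 hlam0
  have hγu : ∀ i, ∃ y ∈ 𝒪[K], y * (![j u, lam, ι lam] : Fin 3 → K) i = 1 := fun i =>
    ⟨σK _, (v_le_one_iff_mem_integer _).1 (by rw [hσKv]; exact hO _ (hγO i)), by rw [hσγ, inv_mul_cancel₀ (hγne i)]⟩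
  obtain ⟨r, hr⟩ := exists_poly_eval_mul_eq_one 𝒪[K] hγO hγu
  have hγ1 : ∀ i, Valued.v (1 + (![j u, lam, ι lam] : Fin 3 → K) i) = 1 := by
    intro i
    fin_cases i
    · exact hv1ju
    · exact hv1lam
    · exact hv1ιlam
  have hγ1ne : ∀ i, (1 + (![j u, lam, ι lam] : Fin 3 → K) i) ≠ 0 := fun i h => by
    have h1 := hγ1 i
    rw [h, map_zero] at h1
    exact zero_ne_one h1
  have hγ1u : ∀ i, ∃ y ∈ 𝒪[K], y * (1 + (![j u, lam, ι lam] : Fin 3 → K) i) = 1 := fun i =>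
    ⟨(1 + (![j u, lam, ι lam] : Fin 3 → K) i)⁻¹, (v_le_one_iff_mem_integer _).1 (by rw [map_inv₀, hγ1 i, inv_one]), inv_mul_cancel₀ (hγ1ne i)⟩
  -- congruent nodes: all `≡ 1`
  have hnear1 : ∀ i, Valued.v ((![j u, lam, ι lam] : Fin 3 → K) i - 1) < 1 := by
    intro i
    fin_cases i
    · exact hju1
    · exact hlam1
    · exact hιlam1
  have hγc : ∀ i k, Valued.v ((![j u, lam, ι lam] : Fin 3 → K) i - (![j u, lam, ι lam] : Fin 3 → K) k) < 1 := fun i k => by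
    have heq : (![j u, lam, ι lam] : Fin 3 → K) i - (![j u, lam, ι lam] : Fin 3 → K) k
        = ((![j u, lam, ι lam] : Fin 3 → K) i - 1) - ((![j u, lam, ι lam] : Fin 3 → K) k - 1) := by ring
    rw [heq]
    exact lt_of_le_of_lt (Valuation.map_sub _ _ _) (max_lt (hnear1 i) (hnear1 k))
  -- Vieta: `λ + ιλ = jt`, `λ·ιλ = jD`
  have hquad' : (ι lam) ^ 2 - j t * ι lam + j D = 0 := by
    have h := congrArg ι hquad
    rwa [map_add, map_sub, map_mul, map_pow, hιj, hιj, map_zero] at h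
  have hsum : (![j u, lam, ι lam] : Fin 3 → K) 1 + (![j u, lam, ι lam] : Fin 3 → K) 2 = j t := by
    show lam + ι lam = j t
    have h : (lam - ι lam) * (lam + ι lam - j t) = 0 := by linear_combination hquad - hquad'
    rcases mul_eq_zero.1 h with h | h
    · exact absurd (sub_eq_zero.1 h).symm hne
    · exact sub_eq_zero.1 h
  have hprod : (![j u, lam, ι lam] : Fin 3 → K) 1 * (![j u, lam, ι lam] : Fin 3 → K) 2 = j D := by
    show lam * ι lam = j D
    have hs : lam + ι lam = j t := hsum
    linear_combination (ι lam) * hs - hquad'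
  -- distinctness
  have h12 : lam ≠ ι lam := fun h => hne h.symm
  have h01 : j u ≠ lam := fun h => hne (by rw [← h, hιj])
  have h02 : j u ≠ ι lam := fun h => h01 (by rw [← hιj u, h, hιι])
  have hinj : Function.Injective (![j u, lam, ι lam] : Fin 3 → K) := by
    intro a b hab
    fin_cases a <;> fin_cases b
    all_goals
      first
      | rfl
      | exact absurd hab h01
      | exact absurd hab.symm h01
      | exact absurd hab h02
      | exact absurd hab.symm h02
      | exact absurd hab h12
      | exact absurd hab.symm h12
  have hιγ0 : ι ((![j u, lam, ι lam] : Fin 3 → K) 0) = (![j u, lam, ι lam] : Fin 3 → K) 0 := hιj u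
  have hιγ1 : ι ((![j u, lam, ι lam] : Fin 3 → K) 1) = (![j u, lam, ι lam] : Fin 3 → K) 2 := rfl
  have hιγ2 : ι ((![j u, lam, ι lam] : Fin 3 → K) 2) = (![j u, lam, ι lam] : Fin 3 → K) 1 := hιι lam
  /- §2 the symmetric eigenframe (★ frame) and the Gram values `d = (j d₀, d₁, ι d₁)` -/
  have hJdet : (J : Matrix (Fin 3) (Fin 3) E).det ≠ 0 := (Matrix.isUnits_det_units J).ne_zero
  have hlam : ((τ.map j).charpoly).IsRoot lam := by
    rw [Matrix.charpoly_map, hχ, Polynomial.map_mul, Polynomial.root_mul]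
    refine Or.inr ?_
    simp only [Polynomial.map_add, Polynomial.map_sub, Polynomial.map_mul, Polynomial.map_pow, Polynomial.map_X, Polynomial.map_C,
      Polynomial.IsRoot.def, Polynomial.eval_add, Polynomial.eval_sub, Polynomial.eval_mul, Polynomial.eval_pow, Polynomial.eval_X,
      Polynomial.eval_C]
    exact hquad
  obtain ⟨P, d₁, hτ, -, hP0, hP1, hP2, hGram, hd₁σ, hd₁0, hd₀0⟩ :=
    exists_symmetric_eigenframe j σ σK ι hσj hιj hσKι hιι hσKσK (J : Matrix (Fin 3) (Fin 3) E) hJh hJdet τ hτU hx₀ hx₀0 hlam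
      (by rw [mul_comm]; exact hσlam) hσu h01 h02 h12
  set d₀ : E := ∑ k, ∑ i, σ (x₀ i) * (J : Matrix (Fin 3) (Fin 3) E) i k * x₀ k with hd₀
  have hJki : ∀ i k, σ ((J : Matrix (Fin 3) (Fin 3) E) i k) = (J : Matrix (Fin 3) (Fin 3) E) k i := fun i k => by
    have h := congrFun (congrFun hJh k) i
    rwa [Matrix.transpose_apply, Matrix.map_apply] at h
  have hσd₀ : σ d₀ = d₀ := by
    rw [hd₀, map_sum]
    simp_rw [map_sum, map_mul, hσσ, hJki]
    rw [Finset.sum_comm]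
    refine Finset.sum_congr rfl fun a _ => Finset.sum_congr rfl fun b _ => ?_
    ring
  have hjd₀0 : j d₀ ≠ 0 := (map_ne_zero j).2 hd₀0
  have hdσ : ∀ i, σK ((![j d₀, d₁, ι d₁] : Fin 3 → K) i) = (![j d₀, d₁, ι d₁] : Fin 3 → K) i := by
    intro i
    fin_cases i
    · show σK (j d₀) = j d₀
      rw [hσj, hσd₀]
    · exact hd₁σ
    · show σK (ι d₁) = ι d₁
      rw [hσKι, hd₁σ]
  have hdne : ∀ i, (![j d₀, d₁, ι d₁] : Fin 3 → K) i ≠ 0 := by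
    intro i
    fin_cases i
    · exact hjd₀0
    · exact hd₁0
    · exact (map_ne_zero ι).2 hd₁0
  have hιd0 : ι ((![j d₀, d₁, ι d₁] : Fin 3 → K) 0) = (![j d₀, d₁, ι d₁] : Fin 3 → K) 0 := hιj d₀
  have hιd1 : ι ((![j d₀, d₁, ι d₁] : Fin 3 → K) 1) = (![j d₀, d₁, ι d₁] : Fin 3 → K) 2 := rfl
  /- §3 the frame-level law, then the eigen-data rewrite -/
  refine (hlaw P _ _ r hτ hGram hP0 hP1 hP2 hγO hinj hσγ hr hγ1u hγne hγc hιγ0 hιγ1 hιγ2 hdσ hdne hιd0 hιd1).trans ?_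
  exact exists_rational_norm_law_iff_of_eigenData j σ σK ι hσj hιj' hσKι hιθ hθ0 hσγ hγne hγ1ne h12 hιγ1 hιγ2
    (show (![j u, lam, ι lam] : Fin 3 → K) 0 = j u from rfl) hsum hprod (show (![j d₀, d₁, ι d₁] : Fin 3 → K) 0 = j d₀ from rfl) _

end Literature.NumberTheory.Automorphic.SymmetricEigenframe

end
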